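import Summits.AtomisticToContinuum.Crystallization.Theorems.FreeSplittingCertificatesStrictSplittingRuleP1ReadLegs
import Summits.AtomisticToContinuum.Crystallization.Theorems.FreeSplittingCertificatesStrictSplittingRuleP1FluxFormQuad
import Summits.AtomisticToContinuum.Crystallization.Theorems.FreeSplittingCertificatesStrictSplittingRuleSummableTransfer

/-!
# `StrictSplittingRule` (stmt-AtomisticToContinuum-12560): SUMMABILITY of the readout bookkeeping families — the allocation table conserves the total load, and every summability hypothesis of parts 37/38 is discharged for the far-ledger field (P1 interpolant object, part 40)

Route `FreeSplittingCertificates`, crux r3 `StrictSplittingRule` (H12⋆ = `stub_coreJointCoercive`), unit b2b-freesplit-B gen 32.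
VALUE = the assembly-level obligation left open by parts 37/38 (HOME CERT §31 (d): "the assembly must supply the summability of the cell
family"): the readout regrouping over an arbitrary per-cell ALLOCATION TABLE (`tsum_readout_leg_table_le`, part 37) and the routed vertical
readout (`tsum_readout_route_le_legs`, part 38) were proved modulo the summability of their right-hand (cell-indexed / leg-indexed) families.
Here:
* **`shareTable_summable_and_tsum_eq`** (abstract): a nonnegative share table `θ e T` with finite sections and unit row sums CONSERVES every
  nonnegative summable load `g`: `T ↦ Σᶠ_e θ e T·g e` is summable and `Σ'_T Σᶠ_e θ e T·g e = Σ'_e g e` (nonnegative Fubini,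
  `summable_prod_of_nonneg` + `tsum_comm'`);
* **`summable_readout_cellFamily`**: hence the cell family of part 37 is summable as soon as the leg loads `w e·|y_{q+s} − y_q|²` are summable and
  the cell gradients `|G_T|²_F` are bounded — and **`tsum_readout_leg_table_le_of_bounded`** is part 37 with its hypothesis `hs` so discharged;
* the FAR-LEDGER LATTICE FIELD `V = p1DispSite a h U b₀ A` (samples of `p1Disp`, part 30: `p1Disp = p1Field ∘ V`) of a finitely supported `U`:
  **`p1CellGrad_p1DispSite`** (`G_T(V) = G_T(U) − A`, linear precision), **`exists_bound_fpFrob_p1CellGrad_p1DispSite`** (cell gradients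
  bounded: uniform slope bound of part 7 + `‖A‖`), **`exists_bound_readout_p1DispSite`** (every bond readout `|V(q+s) − V q|²` bounded in `q`
  for each offset `s`: Lipschitz field + Bravais covariance `h1_sub_eq`);
* **`tsum_readout_leg_table_le_p1DispSite`** and **`tsum_readout_route_le_legs_p1DispSite`**: parts 37 and 38 for that field with NO summability
  hypothesis left — only summable leg weights (for the table) resp. summable bond weights and intermediate offsets from a finite set (for the route);
* **`summable_readoutWeight_of_decay`**: the readout-form weights of H12⋆'s first-order design, `w(q,s) = [s ∈ Y₁]·|β(b_q)(p−q)(s)|/2`, times the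
  bond lengths² ARE such a summable leg load (decay `|β(b_q)(p−q)(s)| ≤ C(1+‖y_q−y_p‖)⁻⁶` in the convention of `CoreJointCoercive`).
So "bond readout → legs → cells" holds for the assembly's field and H12⋆'s weights with every analytic side condition discharged; what the
assembly still supplies is the identification of a concrete table (rule v31) and the per-cell budget (certificate tier).
NOT a proof of H12⋆, NOT summit progress.  [folklore]
-/

noncomputable section

open Set Function
open scoped BigOperators NNReal

namespace Summit.AtomisticToContinuum.Crystallization.Theorems.StrictSplittingRuleBirth

open Literature.MathematicalPhysics.StatisticalMechanics
open Summit.AtomisticToContinuum.Crystallization.Theorems.PalmUnimodularRigidity.LayeredLawsSelectHcp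

/-! ## An allocation table conserves the total load -/

/-- **Load conservation of a share table** (abstract nonnegative Fubini): for `θ ≥ 0` with finite support in each variable and unit row sums
`Σᶠ_T θ e T = 1`, and a nonnegative summable load `g`, the cell-indexed family `T ↦ Σᶠ_e θ e T·g e` is summable and its sum is `Σ'_e g e`.
NOT a proof of H12⋆, NOT summit progress. -/
theorem shareTable_summable_and_tsum_eq {E C : Type*} (θ : E → C → ℝ) (g : E → ℝ) (hθ : ∀ e T, 0 ≤ θ e T) (hg : ∀ e, 0 ≤ g e)
    (hfinE : ∀ e, (Function.support (θ e)).Finite) (hfinC : ∀ T, (Function.support fun e => θ e T).Finite)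
    (hsum : ∀ e, ∑ᶠ T, θ e T = 1) (hs : Summable g) :
    Summable (fun T => ∑ᶠ e, θ e T * g e) ∧ ∑' T, ∑ᶠ e, θ e T * g e = ∑' e, g e := by
  -- supports of the product family sit inside the supports of θ
  have hfinFE : ∀ e, (Function.support fun T => θ e T * g e).Finite := fun e =>
    (hfinE e).subset fun T hT => by
      simp only [Function.mem_support, ne_eq] at hT ⊢
      exact fun h0 => hT (by rw [h0, zero_mul])
  have hfinFC : ∀ T, (Function.support fun e => θ e T * g e).Finite := fun T =>
    (hfinC T).subset fun e he => by
      simp only [Function.mem_support, ne_eq] at he ⊢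
      exact fun h0 => he (by rw [h0, zero_mul])
  -- rows (fixed leg) and columns (fixed cell) are finite sums
  have hrow : ∀ e, Summable fun T => θ e T * g e := fun e => summable_of_hasFiniteSupport (hfinFE e)
  have hcol : ∀ T, Summable fun e => θ e T * g e := fun T => summable_of_hasFiniteSupport (hfinFC T)
  have hrow_eq : ∀ e, ∑' T, θ e T * g e = g e := fun e => by
    rw [tsum_eq_finsum (hfinFE e), ← finsum_mul' _ _ (hfinE e), hsum e, one_mul]
  have hcol_eq : ∀ T, ∑' e, θ e T * g e = ∑ᶠ e, θ e T * g e := fun T => tsum_eq_finsum (hfinFC T)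
  -- the uncurried family is summable on E × C: rows summable, row sums = g summable
  have hFs : Summable (Function.uncurry fun e T => θ e T * g e) := by
    refine (summable_prod_of_nonneg fun p => mul_nonneg (hθ _ _) (hg _)).2 ⟨hrow, ?_⟩
    exact hs.congr fun e => (hrow_eq e).symm
  -- swap to C × E and take the C-marginal
  have hGs : Summable (fun p : C × E => θ p.2 p.1 * g p.2) := by
    have : (fun p : C × E => θ p.2 p.1 * g p.2) = (Function.uncurry fun e T => θ e T * g e) ∘ (Equiv.prodComm C E) := by
      funext p; rfl
    rw [this]; exact (Equiv.summable_iff _).2 hFs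
  have hmargC : Summable fun T => ∑' e, θ e T * g e := hGs.prod
  refine ⟨hmargC.congr fun T => hcol_eq T, ?_⟩
  calc ∑' T, ∑ᶠ e, θ e T * g e = ∑' T, ∑' e, θ e T * g e := tsum_congr fun T => (hcol_eq T).symm
    _ = ∑' e, ∑' T, θ e T * g e := hFs.tsum_comm' hrow hcol
    _ = ∑' e, g e := tsum_congr hrow_eq

/-! ## The cell family of the readout regrouping is summable (bounded gradients, summable loads) -/

/-- **Summability of the cell family of part 37**: for a share table `θ` (nonnegative, finite sections, unit row sums), nonnegative leg weights with
summable loads `w e·|y_{q+s} − y_q|²`, and lattice values `V` whose cell gradients are bounded in Frobenius norm, the cell-indexed capacity family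
`T ↦ (Σᶠ_e θ e T·w e·|y_{q+s} − y_q|²)·|G_T|²_F` is summable.  NOT a proof of H12⋆, NOT summit progress. -/
theorem summable_readout_cellFamily {a h : ℝ} (V : ℤ × ℤ × ℤ → (Fin 3 → ℝ))
    (w : (ℤ × ℤ × ℤ) × (ℤ × ℤ × ℤ) → ℝ) (hw : ∀ e, 0 ≤ w e)
    (θ : (ℤ × ℤ × ℤ) × (ℤ × ℤ × ℤ) → (ℤ × ℤ × ℤ) × Fin 6 → ℝ) (hθ : ∀ e T, 0 ≤ θ e T)
    (hfinE : ∀ e, (Function.support (θ e)).Finite) (hfinC : ∀ T, (Function.support fun e => θ e T).Finite)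
    (hsum : ∀ e, ∑ᶠ T, θ e T = 1) {B : ℝ} (hB : ∀ T, fpFrob (p1CellGrad a h V T) ≤ B)
    (hws : Summable fun e : (ℤ × ℤ × ℤ) × (ℤ × ℤ × ℤ) => w e * fpSq (fun k => hcpSite a h (e.1 + e.2) k - hcpSite a h e.1 k)) :
    Summable fun T : (ℤ × ℤ × ℤ) × Fin 6 =>
      (∑ᶠ e, θ e T * w e * fpSq (fun k => hcpSite a h (e.1 + e.2) k - hcpSite a h e.1 k)) * fpFrob (p1CellGrad a h V T) := by
  set g : (ℤ × ℤ × ℤ) × (ℤ × ℤ × ℤ) → ℝ := fun e => w e * fpSq (fun k => hcpSite a h (e.1 + e.2) k - hcpSite a h e.1 k) with hgdef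
  have hg : ∀ e, 0 ≤ g e := fun e => mul_nonneg (hw e) (fpSq_nonneg _)
  obtain ⟨hload, -⟩ := shareTable_summable_and_tsum_eq θ g hθ hg hfinE hfinC hsum hws
  have hF0 : ∀ T, 0 ≤ fpFrob (p1CellGrad a h V T) := fun T => by unfold fpFrob; positivity
  have hB0 : 0 ≤ B := (hF0 ((0, 0, 0), 0)).trans (hB _)
  have hcell : ∀ T, ∑ᶠ e, θ e T * w e * fpSq (fun k => hcpSite a h (e.1 + e.2) k - hcpSite a h e.1 k) = ∑ᶠ e, θ e T * g e :=
    fun T => finsum_congr fun e => by rw [hgdef, mul_assoc]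
  have hload0 : ∀ T, 0 ≤ ∑ᶠ e, θ e T * g e := fun T => finsum_nonneg fun e => mul_nonneg (hθ e T) (hg e)
  refine Summable.of_nonneg_of_le (fun T => ?_) (fun T => ?_) (hload.mul_right B)
  · rw [hcell]; exact mul_nonneg (hload0 T) (hF0 T)
  · rw [hcell]; exact mul_le_mul_of_nonneg_left (hB T) (hload0 T)

/-- **Part 37 with the summability hypothesis discharged**: the readout regrouping over an allocation table,
`Σ'_e w e·|V(q+s) − V q|² ≤ Σ'_T (Σᶠ_e θ e T·w e·|y_{q+s} − y_q|²)·|G_T|²_F`, for lattice values with bounded cell gradients and summable leg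
loads.  NOT a proof of H12⋆, NOT summit progress. -/
theorem tsum_readout_leg_table_le_of_bounded {a h : ℝ} (ha : a ≠ 0) (hh : h ≠ 0) (V : ℤ × ℤ × ℤ → (Fin 3 → ℝ))
    (w : (ℤ × ℤ × ℤ) × (ℤ × ℤ × ℤ) → ℝ) (hw : ∀ e, 0 ≤ w e)
    (θ : (ℤ × ℤ × ℤ) × (ℤ × ℤ × ℤ) → (ℤ × ℤ × ℤ) × Fin 6 → ℝ) (hθ : ∀ e T, 0 ≤ θ e T)
    (hfinE : ∀ e, (Function.support (θ e)).Finite) (hfinC : ∀ T, (Function.support fun e => θ e T).Finite)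
    (hsum : ∀ e, ∑ᶠ T, θ e T = 1)
    (hcar : ∀ e T, θ e T ≠ 0 → ∃ m m' : Fin 4, e.1 = T.1 + p1VertOff (p1Par T.1) T.2 m ∧
      e.1 + e.2 = T.1 + p1VertOff (p1Par T.1) T.2 m')
    {B : ℝ} (hB : ∀ T, fpFrob (p1CellGrad a h V T) ≤ B)
    (hws : Summable fun e : (ℤ × ℤ × ℤ) × (ℤ × ℤ × ℤ) => w e * fpSq (fun k => hcpSite a h (e.1 + e.2) k - hcpSite a h e.1 k)) :
    Summable (fun e : (ℤ × ℤ × ℤ) × (ℤ × ℤ × ℤ) => w e * fpSq (fun k => V (e.1 + e.2) k - V e.1 k)) ∧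
    ∑' e : (ℤ × ℤ × ℤ) × (ℤ × ℤ × ℤ), w e * fpSq (fun k => V (e.1 + e.2) k - V e.1 k) ≤
    ∑' T : (ℤ × ℤ × ℤ) × Fin 6,
      (∑ᶠ e, θ e T * w e * fpSq (fun k => hcpSite a h (e.1 + e.2) k - hcpSite a h e.1 k)) * fpFrob (p1CellGrad a h V T) :=
  tsum_readout_leg_table_le ha hh V w hw θ hθ hfinE hfinC hsum hcar
    (summable_readout_cellFamily V w hw θ hθ hfinE hfinC hsum hB hws)

/-- **Load conservation for the readout table**: the total cell load equals the total leg load,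
`Σ'_T Σᶠ_e θ e T·w e·|y_{q+s} − y_q|² = Σ'_e w e·|y_{q+s} − y_q|²` (no load is created or lost by the allocation; the shed set only moves weight to
zero rows upstream).  NOT a proof of H12⋆, NOT summit progress. -/
theorem tsum_cellLoad_eq_tsum_legLoad {a h : ℝ} (w : (ℤ × ℤ × ℤ) × (ℤ × ℤ × ℤ) → ℝ) (hw : ∀ e, 0 ≤ w e)
    (θ : (ℤ × ℤ × ℤ) × (ℤ × ℤ × ℤ) → (ℤ × ℤ × ℤ) × Fin 6 → ℝ) (hθ : ∀ e T, 0 ≤ θ e T)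
    (hfinE : ∀ e, (Function.support (θ e)).Finite) (hfinC : ∀ T, (Function.support fun e => θ e T).Finite)
    (hsum : ∀ e, ∑ᶠ T, θ e T = 1)
    (hws : Summable fun e : (ℤ × ℤ × ℤ) × (ℤ × ℤ × ℤ) => w e * fpSq (fun k => hcpSite a h (e.1 + e.2) k - hcpSite a h e.1 k)) :
    Summable (fun T : (ℤ × ℤ × ℤ) × Fin 6 => ∑ᶠ e, θ e T * w e * fpSq (fun k => hcpSite a h (e.1 + e.2) k - hcpSite a h e.1 k)) ∧
    ∑' T : (ℤ × ℤ × ℤ) × Fin 6, ∑ᶠ e, θ e T * w e * fpSq (fun k => hcpSite a h (e.1 + e.2) k - hcpSite a h e.1 k) =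
      ∑' e : (ℤ × ℤ × ℤ) × (ℤ × ℤ × ℤ), w e * fpSq (fun k => hcpSite a h (e.1 + e.2) k - hcpSite a h e.1 k) := by
  have hcell : ∀ T : (ℤ × ℤ × ℤ) × Fin 6,
      ∑ᶠ e, θ e T * w e * fpSq (fun k => hcpSite a h (e.1 + e.2) k - hcpSite a h e.1 k) =
        ∑ᶠ e, θ e T * (w e * fpSq (fun k => hcpSite a h (e.1 + e.2) k - hcpSite a h e.1 k)) :=
    fun T => finsum_congr fun e => by rw [mul_assoc]
  obtain ⟨h1, h2⟩ := shareTable_summable_and_tsum_eq θ _ hθ (fun e => mul_nonneg (hw e) (fpSq_nonneg _)) hfinE hfinC hsum hws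
  refine ⟨h1.congr fun T => (hcell T).symm, ?_⟩
  rw [← h2]
  exact tsum_congr fun T => hcell T

/-! ## The far-ledger lattice field: cell gradients and bond readouts are bounded -/

/-- **Linear precision at the level of cell gradients**: for the far-ledger lattice field `V = p1DispSite a h U b₀ A` (the samples of `p1Disp`),
`G_T(V) = G_T(U) − A` on every cell.  NOT a proof of H12⋆, NOT summit progress. -/
theorem p1CellGrad_p1DispSite {a h : ℝ} (ha : 0 < a) (hh : 0 < h) (U : ℤ × ℤ × ℤ → (Fin 3 → ℝ)) (b₀ : Fin 3 → ℝ)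
    (A : Fin 3 → Fin 3 → ℝ) (T : (ℤ × ℤ × ℤ) × Fin 6) :
    p1CellGrad a h (fun n k => p1DispSite a h U b₀ A n k) T = fun j k => p1CellGrad a h U T j k - A j k := by
  obtain ⟨x, hx⟩ := interior_p1RealCell_nonempty ha hh T
  rw [← fpGrad_p1Disp U b₀ A hx, p1Disp_eq_p1Field ha.ne' hh.ne' U b₀ A]
  exact (fpGrad_p1Field _ hx).symm

/-- The unit coordinate vectors have sup norm at most one. -/
theorem norm_fpE_le (j : Fin 3) : ‖fpE j‖ ≤ 1 := by
  refine (pi_norm_le_iff_of_nonneg zero_le_one).2 fun k => ?_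
  fin_cases j <;> fin_cases k <;> simp [fpE]

/-- **Frobenius norm from the operator norm**: the matrix `(j,k) ↦ (L e_j)_k` of a continuous linear map with `‖L‖ ≤ K` has `|·|²_F ≤ 9K²`. -/
theorem fpFrob_le_of_opNorm_le {L : (Fin 3 → ℝ) →L[ℝ] (Fin 3 → ℝ)} {K : ℝ} (hL : ‖L‖ ≤ K) :
    fpFrob (fun j k => L (fpE j) k) ≤ 9 * K ^ 2 := by
  have hK : 0 ≤ K := (norm_nonneg L).trans hL
  have hent : ∀ j k, (L (fpE j) k) ^ 2 ≤ K ^ 2 := by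
    intro j k
    have h1 : |L (fpE j) k| ≤ K := by
      calc |L (fpE j) k| = ‖L (fpE j) k‖ := (Real.norm_eq_abs _).symm
        _ ≤ ‖L (fpE j)‖ := norm_le_pi_norm _ k
        _ ≤ ‖L‖ * ‖fpE j‖ := L.le_opNorm _
        _ ≤ K * 1 := mul_le_mul hL (norm_fpE_le j) (norm_nonneg _) hK
        _ = K := mul_one K
    exact sq_le_sq' (by linarith [neg_abs_le (L (fpE j) k)]) ((le_abs_self _).trans h1)
  unfold fpFrob
  linarith [hent 0 0, hent 0 1, hent 0 2, hent 1 0, hent 1 1, hent 1 2, hent 2 0, hent 2 1, hent 2 2]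

/-- **The cell gradients of the far-ledger lattice field are bounded** (finitely supported `U`): `|G_T(U) − A|²_F ≤ 9(K + ‖A‖)²` uniformly in `T`,
with `K` the uniform slope bound of part 7.  NOT a proof of H12⋆, NOT summit progress. -/
theorem exists_bound_fpFrob_p1CellGrad_p1DispSite {a h : ℝ} (ha : 0 < a) (hh : 0 < h) (U : ℤ × ℤ × ℤ → (Fin 3 → ℝ))
    (hU : (support U).Finite) (b₀ : Fin 3 → ℝ) (A : Fin 3 → Fin 3 → ℝ) :
    ∃ B : ℝ, ∀ T, fpFrob (p1CellGrad a h (fun n k => p1DispSite a h U b₀ A n k) T) ≤ B := by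
  obtain ⟨K, hK⟩ := exists_bound_p1CellMap a h U hU
  refine ⟨9 * (((K + ‖p1AffCLM A‖₊ : ℝ≥0) : ℝ)) ^ 2, fun T => ?_⟩
  rw [p1CellGrad_p1DispSite ha hh]
  have hid : (fun j k => p1CellGrad a h U T j k - A j k) = fun j k => (p1CellMap a h U T - p1AffCLM A) (fpE j) k := by
    funext j k
    fin_cases j <;> simp [p1CellGrad, fpE]
  rw [hid]
  exact fpFrob_le_of_opNorm_le (norm_p1CellMap_sub_le hK A T)

/-- **Every bond readout of the far-ledger lattice field is bounded**, uniformly in the base site, for each fixed offset `s`: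
`|V(q+s) − V q|² ≤ 3(K·max(‖y_s‖, ‖y_{−s}‖))²` (Lipschitz field, part 15; Bravais covariance `y_{q+s} − y_q ∈ {y_s, −y_{−s}}`).
NOT a proof of H12⋆, NOT summit progress. -/
theorem exists_bound_readout_p1DispSite {a h : ℝ} (ha : 0 < a) (hh : 0 < h) (U : ℤ × ℤ × ℤ → (Fin 3 → ℝ))
    (hU : (support U).Finite) (b₀ : Fin 3 → ℝ) (A : Fin 3 → Fin 3 → ℝ) (s : ℤ × ℤ × ℤ) :
    ∃ B : ℝ, ∀ q, fpSq (fun k => p1DispSite a h U b₀ A (q + s) k - p1DispSite a h U b₀ A q k) ≤ B := by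
  obtain ⟨K, hK⟩ := exists_lipschitzWith_p1Disp ha.ne' hh.ne' U hU b₀ A
  refine ⟨3 * ((K : ℝ) * max ‖hcpSite a h s‖ ‖hcpSite a h (-s)‖) ^ 2, fun q => ?_⟩
  set L : ℝ := max ‖hcpSite a h s‖ ‖hcpSite a h (-s)‖ with hL
  have hL0 : 0 ≤ L := (norm_nonneg _).trans (le_max_left _ _)
  -- the two site-coordinate vectors are within sup-distance L
  have hdist : dist (fun j => hcpSite a h (q + s) j) (fun j => hcpSite a h q j) ≤ L := by
    refine (dist_pi_le_iff hL0).2 fun j => ?_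
    rw [Real.dist_eq, ← PiLp.sub_apply, h1_sub_eq a h q s]
    split_ifs with hq
    · exact ((Real.norm_eq_abs _).symm.le.trans (PiLp.norm_apply_le (hcpSite a h s) j)).trans (le_max_left _ _)
    · rw [PiLp.neg_apply, abs_neg]
      exact ((Real.norm_eq_abs _).symm.le.trans (PiLp.norm_apply_le (hcpSite a h (-s)) j)).trans (le_max_right _ _)
  -- Lipschitz ⇒ every component of the value difference is at most K·L
  have hV : ∀ k, |p1DispSite a h U b₀ A (q + s) k - p1DispSite a h U b₀ A q k| ≤ K * L := by
    intro k
    have h2 : dist (p1Disp a h U b₀ A fun j => hcpSite a h (q + s) j) (p1Disp a h U b₀ A fun j => hcpSite a h q j) ≤ K * L :=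
      (hK.dist_le_mul _ _).trans (mul_le_mul_of_nonneg_left hdist K.2)
    have h3 := dist_le_pi_dist (p1Disp a h U b₀ A fun j => hcpSite a h (q + s) j) (p1Disp a h U b₀ A fun j => hcpSite a h q j) k
    rw [Real.dist_eq] at h3
    simp only [p1DispSite, PiLp.toLp_apply]
    exact h3.trans h2
  have hsq : ∀ k, (p1DispSite a h U b₀ A (q + s) k - p1DispSite a h U b₀ A q k) ^ 2 ≤ ((K : ℝ) * L) ^ 2 := fun k =>
    sq_le_sq' (abs_le.1 (hV k)).1 (abs_le.1 (hV k)).2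
  unfold fpSq
  linarith [hsq 0, hsq 1, hsq 2]

/-! ## Parts 37 and 38 for the far-ledger field, no summability hypothesis left -/

/-- **THE READOUT REGROUPING OVER AN ALLOCATION TABLE FOR THE FAR-LEDGER FIELD**: for `V = p1DispSite a h U b₀ A` with `U` finitely supported,
nonnegative leg weights with summable loads and ANY share table with the carrier property,
`Σ'_e w e·|V(q+s) − V q|² ≤ Σ'_T (Σᶠ_e θ e T·w e·|y_{q+s} − y_q|²)·|G_T(U) − A|²_F`, both sides summable.  NOT a proof of H12⋆, NOT summit progress. -/
theorem tsum_readout_leg_table_le_p1DispSite {a h : ℝ} (ha : 0 < a) (hh : 0 < h) (U : ℤ × ℤ × ℤ → (Fin 3 → ℝ))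
    (hU : (support U).Finite) (b₀ : Fin 3 → ℝ) (A : Fin 3 → Fin 3 → ℝ)
    (w : (ℤ × ℤ × ℤ) × (ℤ × ℤ × ℤ) → ℝ) (hw : ∀ e, 0 ≤ w e)
    (θ : (ℤ × ℤ × ℤ) × (ℤ × ℤ × ℤ) → (ℤ × ℤ × ℤ) × Fin 6 → ℝ) (hθ : ∀ e T, 0 ≤ θ e T)
    (hfinE : ∀ e, (Function.support (θ e)).Finite) (hfinC : ∀ T, (Function.support fun e => θ e T).Finite)
    (hsum : ∀ e, ∑ᶠ T, θ e T = 1)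
    (hcar : ∀ e T, θ e T ≠ 0 → ∃ m m' : Fin 4, e.1 = T.1 + p1VertOff (p1Par T.1) T.2 m ∧
      e.1 + e.2 = T.1 + p1VertOff (p1Par T.1) T.2 m')
    (hws : Summable fun e : (ℤ × ℤ × ℤ) × (ℤ × ℤ × ℤ) => w e * fpSq (fun k => hcpSite a h (e.1 + e.2) k - hcpSite a h e.1 k)) :
    Summable (fun T : (ℤ × ℤ × ℤ) × Fin 6 =>
      (∑ᶠ e, θ e T * w e * fpSq (fun k => hcpSite a h (e.1 + e.2) k - hcpSite a h e.1 k)) *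
        fpFrob (fun j k => p1CellGrad a h U T j k - A j k)) ∧
    Summable (fun e : (ℤ × ℤ × ℤ) × (ℤ × ℤ × ℤ) =>
      w e * fpSq (fun k => p1DispSite a h U b₀ A (e.1 + e.2) k - p1DispSite a h U b₀ A e.1 k)) ∧
    ∑' e : (ℤ × ℤ × ℤ) × (ℤ × ℤ × ℤ), w e * fpSq (fun k => p1DispSite a h U b₀ A (e.1 + e.2) k - p1DispSite a h U b₀ A e.1 k) ≤
    ∑' T : (ℤ × ℤ × ℤ) × Fin 6,
      (∑ᶠ e, θ e T * w e * fpSq (fun k => hcpSite a h (e.1 + e.2) k - hcpSite a h e.1 k)) *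
        fpFrob (fun j k => p1CellGrad a h U T j k - A j k) := by
  obtain ⟨B, hB⟩ := exists_bound_fpFrob_p1CellGrad_p1DispSite ha hh U hU b₀ A
  have hs := summable_readout_cellFamily (fun n k => p1DispSite a h U b₀ A n k) w hw θ hθ hfinE hfinC hsum hB hws
  have hmain := tsum_readout_leg_table_le ha.ne' hh.ne' (fun n k => p1DispSite a h U b₀ A n k) w hw θ hθ hfinE hfinC hsum hcar hs
  simp only [p1CellGrad_p1DispSite ha hh] at hs hmain
  exact ⟨hs, hmain.1, hmain.2⟩

/-- **THE ROUTED READOUT FOR THE FAR-LEDGER FIELD**: for `V = p1DispSite a h U b₀ A` with `U` finitely supported, a bond offset `s`, intermediate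
offsets `o q i` drawn from a finite set, and nonnegative summable bond weights `wv`,
`Σ'_q wv q·|V(q+s) − V q|² ≤ Σ'_q (2/3)·wv q·Σ_i (|V(q + o q i) − V q|² + |V(q+s) − V(q + o q i)|²)`, both sides summable.
NOT a proof of H12⋆, NOT summit progress. -/
theorem tsum_readout_route_le_legs_p1DispSite {a h : ℝ} (ha : 0 < a) (hh : 0 < h) (U : ℤ × ℤ × ℤ → (Fin 3 → ℝ))
    (hU : (support U).Finite) (b₀ : Fin 3 → ℝ) (A : Fin 3 → Fin 3 → ℝ) (s : ℤ × ℤ × ℤ)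
    (o : (ℤ × ℤ × ℤ) → Fin 3 → ℤ × ℤ × ℤ) (S : Finset (ℤ × ℤ × ℤ)) (ho : ∀ q i, o q i ∈ S)
    (wv : ℤ × ℤ × ℤ → ℝ) (hwv : ∀ q, 0 ≤ wv q) (hwvs : Summable wv) :
    Summable (fun q : ℤ × ℤ × ℤ => 2 / 3 * wv q * ∑ i : Fin 3,
      (fpSq (fun k => p1DispSite a h U b₀ A (q + o q i) k - p1DispSite a h U b₀ A q k) +
        fpSq (fun k => p1DispSite a h U b₀ A (q + s) k - p1DispSite a h U b₀ A (q + o q i) k))) ∧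
    Summable (fun q : ℤ × ℤ × ℤ => wv q * fpSq (fun k => p1DispSite a h U b₀ A (q + s) k - p1DispSite a h U b₀ A q k)) ∧
    ∑' q : ℤ × ℤ × ℤ, wv q * fpSq (fun k => p1DispSite a h U b₀ A (q + s) k - p1DispSite a h U b₀ A q k) ≤
      ∑' q : ℤ × ℤ × ℤ, 2 / 3 * wv q * ∑ i : Fin 3,
        (fpSq (fun k => p1DispSite a h U b₀ A (q + o q i) k - p1DispSite a h U b₀ A q k) +
          fpSq (fun k => p1DispSite a h U b₀ A (q + s) k - p1DispSite a h U b₀ A (q + o q i) k)) := by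
  set V : ℤ × ℤ × ℤ → (Fin 3 → ℝ) := fun n k => p1DispSite a h U b₀ A n k with hVdef
  -- a bound for every offset
  have hb : ∀ d : ℤ × ℤ × ℤ, ∃ B : ℝ, ∀ q, fpSq (fun k => V (q + d) k - V q k) ≤ B := fun d =>
    exists_bound_readout_p1DispSite ha hh U hU b₀ A d
  choose Bf hBf using hb
  have hBf0 : ∀ d, 0 ≤ Bf d := fun d => (fpSq_nonneg _).trans (hBf d 0)
  -- uniform bound of the leg sum through the finite offset set
  set M : ℝ := ∑ d ∈ S, (Bf d + Bf (s - d)) with hM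
  have hleg : ∀ q (i : Fin 3), fpSq (fun k => V (q + o q i) k - V q k) + fpSq (fun k => V (q + s) k - V (q + o q i) k) ≤ M := by
    intro q i
    have h1 : fpSq (fun k => V (q + o q i) k - V q k) ≤ Bf (o q i) := hBf _ q
    have h2 : fpSq (fun k => V (q + s) k - V (q + o q i) k) ≤ Bf (s - o q i) := by
      have := hBf (s - o q i) (q + o q i)
      rwa [show q + o q i + (s - o q i) = q + s by abel] at this
    calc fpSq (fun k => V (q + o q i) k - V q k) + fpSq (fun k => V (q + s) k - V (q + o q i) k)
        ≤ Bf (o q i) + Bf (s - o q i) := add_le_add h1 h2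
      _ ≤ M := Finset.single_le_sum (f := fun d => Bf d + Bf (s - d)) (fun d _ => add_nonneg (hBf0 d) (hBf0 _)) (ho q i)
  have hsumle : ∀ q, ∑ i : Fin 3, (fpSq (fun k => V (q + o q i) k - V q k) + fpSq (fun k => V (q + s) k - V (q + o q i) k)) ≤ 3 * M := by
    intro q
    calc ∑ i : Fin 3, (fpSq (fun k => V (q + o q i) k - V q k) + fpSq (fun k => V (q + s) k - V (q + o q i) k))
        ≤ ∑ _i : Fin 3, M := Finset.sum_le_sum fun i _ => hleg q i
      _ = 3 * M := by simp
  have h0 : ∀ q, 0 ≤ 2 / 3 * wv q * ∑ i : Fin 3,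
      (fpSq (fun k => V (q + o q i) k - V q k) + fpSq (fun k => V (q + s) k - V (q + o q i) k)) := fun q =>
    mul_nonneg (by linarith [hwv q]) (Finset.sum_nonneg fun i _ => add_nonneg (fpSq_nonneg _) (fpSq_nonneg _))
  have hs : Summable (fun q : ℤ × ℤ × ℤ => 2 / 3 * wv q * ∑ i : Fin 3,
      (fpSq (fun k => V (q + o q i) k - V q k) + fpSq (fun k => V (q + s) k - V (q + o q i) k))) := by
    refine Summable.of_nonneg_of_le h0 (fun q => ?_) ((hwvs.mul_left (2 / 3)).mul_right (3 * M))
    exact mul_le_mul_of_nonneg_left (hsumle q) (by linarith [hwv q])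
  exact ⟨hs, tsum_readout_route_le_legs V s o wv hwv hs⟩

/-! ## The readout-form weights of H12⋆'s first-order design are a summable leg load -/

/-- **Summability of the readout-form loads**: for a first-order table `β` with the decay of `CoreJointCoercive`
(`|β(b_p)(q−p)(s)| ≤ C(1+‖y_q − y_p‖)⁻⁶` for all `p q s`), a finite stencil `Y₁` and a site `p`, the leg load
`e = (q,s) ↦ [s ∈ Y₁]·(|β(b_q)(p−q)(s)|/2)·|y_{q+s} − y_q|²` is nonnegative and summable over `ℤ³ × ℤ³`.
NOT a proof of H12⋆, NOT summit progress. -/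
theorem summable_readoutWeight_of_decay {a h C : ℝ} (ha : 0 < a) (hh : 0 < h) (Y₁ : Finset (ℤ × ℤ × ℤ))
    (β : Bool → (ℤ × ℤ × ℤ) → (ℤ × ℤ × ℤ) → ℝ)
    (hβ : ∀ p q : ℤ × ℤ × ℤ, ∀ s, |β (decide (Even p.1)) (q - p) s| ≤ C * ((1 + ‖hcpSite a h q - hcpSite a h p‖)⁻¹) ^ 6)
    (p : ℤ × ℤ × ℤ) :
    Summable fun e : (ℤ × ℤ × ℤ) × (ℤ × ℤ × ℤ) =>
      (if e.2 ∈ Y₁ then |β (decide (Even e.1.1)) (p - e.1) e.2| / 2 else 0) *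
        fpSq (fun k => hcpSite a h (e.1 + e.2) k - hcpSite a h e.1 k) := by
  -- bond lengths² are bounded on the stencil, uniformly in the base site
  have hlen : ∀ s : ℤ × ℤ × ℤ, ∀ q : ℤ × ℤ × ℤ,
      fpSq (fun k => hcpSite a h (q + s) k - hcpSite a h q k) ≤ 3 * (max ‖hcpSite a h s‖ ‖hcpSite a h (-s)‖) ^ 2 := by
    intro s q
    set L : ℝ := max ‖hcpSite a h s‖ ‖hcpSite a h (-s)‖ with hL
    have hc : ∀ k, |hcpSite a h (q + s) k - hcpSite a h q k| ≤ L := by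
      intro k
      rw [← PiLp.sub_apply, h1_sub_eq a h q s]
      split_ifs with hq
      · exact ((Real.norm_eq_abs _).symm.le.trans (PiLp.norm_apply_le (hcpSite a h s) k)).trans (le_max_left _ _)
      · rw [PiLp.neg_apply, abs_neg]
        exact ((Real.norm_eq_abs _).symm.le.trans (PiLp.norm_apply_le (hcpSite a h (-s)) k)).trans (le_max_right _ _)
    have hsq : ∀ k, (hcpSite a h (q + s) k - hcpSite a h q k) ^ 2 ≤ L ^ 2 := fun k =>
      sq_le_sq' (abs_le.1 (hc k)).1 (abs_le.1 (hc k)).2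
    unfold fpSq
    linarith [hsq 0, hsq 1, hsq 2]
  -- nonnegativity
  have h0 : ∀ e : (ℤ × ℤ × ℤ) × (ℤ × ℤ × ℤ), 0 ≤ (if e.2 ∈ Y₁ then |β (decide (Even e.1.1)) (p - e.1) e.2| / 2 else 0) *
      fpSq (fun k => hcpSite a h (e.1 + e.2) k - hcpSite a h e.1 k) := fun e =>
    mul_nonneg (by split_ifs <;> positivity) (fpSq_nonneg _)
  -- rows (fixed base site q, offsets s): supported in Y₁
  have hrow : ∀ q : ℤ × ℤ × ℤ, Summable fun s : ℤ × ℤ × ℤ =>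
      (if s ∈ Y₁ then |β (decide (Even q.1)) (p - q) s| / 2 else 0) * fpSq (fun k => hcpSite a h (q + s) k - hcpSite a h q k) := by
    intro q
    refine summable_of_ne_finset_zero (s := Y₁) fun s hs => ?_
    rw [if_neg hs, zero_mul]
  have hrow_eq : ∀ q : ℤ × ℤ × ℤ, ∑' s : ℤ × ℤ × ℤ,
      (if s ∈ Y₁ then |β (decide (Even q.1)) (p - q) s| / 2 else 0) * fpSq (fun k => hcpSite a h (q + s) k - hcpSite a h q k) =
      ∑ s ∈ Y₁, |β (decide (Even q.1)) (p - q) s| / 2 * fpSq (fun k => hcpSite a h (q + s) k - hcpSite a h q k) := by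
    intro q
    rw [tsum_eq_sum (s := Y₁) fun s hs => by rw [if_neg hs, zero_mul]]
    exact Finset.sum_congr rfl fun s hs => by rw [if_pos hs]
  -- the row sums are dominated by the decay weight read from p
  have hmarg : Summable fun q : ℤ × ℤ × ℤ =>
      ∑ s ∈ Y₁, |β (decide (Even q.1)) (p - q) s| / 2 * fpSq (fun k => hcpSite a h (q + s) k - hcpSite a h q k) := by
    refine summable_sum fun s _ => ?_
    refine summableTransfer_summable_of_abs_le ha hh p (C := C / 2 * (3 * (max ‖hcpSite a h s‖ ‖hcpSite a h (-s)‖) ^ 2))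
      fun q => ?_
    have hd := hβ q p s
    rw [norm_sub_rev] at hd
    have hC : 0 ≤ C * ((1 + ‖hcpSite a h q - hcpSite a h p‖)⁻¹) ^ 6 := (abs_nonneg _).trans hd
    rw [abs_mul, abs_of_nonneg (fpSq_nonneg _), abs_div, abs_abs, abs_two]
    calc |β (decide (Even q.1)) (p - q) s| / 2 * fpSq (fun k => hcpSite a h (q + s) k - hcpSite a h q k)
        ≤ C * ((1 + ‖hcpSite a h q - hcpSite a h p‖)⁻¹) ^ 6 / 2 * (3 * (max ‖hcpSite a h s‖ ‖hcpSite a h (-s)‖) ^ 2) :=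
          mul_le_mul (div_le_div_of_nonneg_right hd zero_le_two) (hlen s q) (fpSq_nonneg _) (by positivity)
      _ = C / 2 * (3 * (max ‖hcpSite a h s‖ ‖hcpSite a h (-s)‖) ^ 2) * ((1 + ‖hcpSite a h q - hcpSite a h p‖)⁻¹) ^ 6 := by ring
  refine (summable_prod_of_nonneg h0).2 ⟨hrow, ?_⟩
  exact hmarg.congr fun q => (hrow_eq q).symm

end Summit.AtomisticToContinuum.Crystallization.Theorems.StrictSplittingRuleBirth

end
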